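import Literature.NumberTheory.GaloisRepresentations.GSp4BigImage
import Mathlib.LinearAlgebra.Matrix.BilinearForm
import HarnessLib

/-!
# The stabiliser in `GSp(J)` of a non-degenerate decomposition `k⁴ = P ⊕ P^⊥`
# (the maximal subgroup `N_dec` of index `45` of `GSp₄(𝔽₃)`; LMFDB class `3.45.1`) as the image
# of a framed Galois representation

Topic `Literature/NumberTheory/GaloisRepresentations`, sibling of `GSp4BigImage.lean` (BCGP 2021
§7.5: `gspSubgroup J`, `FramedGaloisRep.imageOn`) and `GSp4Reasonable.lean` (Whitmore Def. 3.19).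
DEFINITIONS with bodies and unfolding API only (D-0026: no named fact).  They give a
generator-free description of ONE of the 15 "ticked" conjugacy classes of subgroups of
`GSp₄(𝔽₃)` of G. Boxer, F. Calegari, T. Gee, V. Pilloni, *Modularity theorems for abelian
surfaces*, arXiv:2502.20645 (2025), Lemma 6.4.3 / Table 6.4.4 — the row
`3.45.1 | 2304 | 1152 | ✓` — namely the stabiliser in `GSp₄(𝔽₃)` of an unordered pair
`{P, P^⊥}` of complementary non-degenerate planes ("stabiliser of a non-degenerate decomposition
as a `⊥`-sum of two planes", order `2304 = |GSp₄(𝔽₃)| / 45`), so that Theorem 9.5.2 of that paper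
can be CONSUMED for its one printed instance (§10.1: "there are three additional curves,
precisely one of which we can deduce is modular by Theorem 9.5.2. This is the curve of conductor
`7³ · 23`. The representation `ρ̄_{A,3}` in this case (with image of order `2304`) is induced from a
representation `ρ̄_{E,3} : G_F → GL₂(𝔽₃)`, where `E` is a modular elliptic curve over
`F = ℚ(√−7)`" — chunk p0138 L91–104 of the held TeX rendering `paper:arxiv-2502.20645`) without
vendoring matrix generators.  Vendored by the literature seat of the venture cell `pub-residmod`
(`run/shared/lean/pub/pub-residmod/lit/BCGP-AS-PRINTED.md` §B3, §D; cell mnemonic `N_dec`,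
certificate slot `IM3-CLASS`).

## What is here (all with bodies; `k` a field, `J ∈ M_n(k)` the Gram matrix, `⟨u, v⟩ = uᵀ J v`)

* `jOrthogonal J P` — `P^⊥ = {v : ∀ u ∈ P, uᵀ J v = 0}` (Mathlib `LinearMap.BilinForm.orthogonal`
  of `Matrix.toBilin' J`; for alternating `J` left and right orthogonals agree).
* `Submodule.IsNondegeneratePlane J P` — `dim_k P = 2` and `k⁴ = P ⊕ P^⊥` (`IsCompl P P^⊥`), i.e.
  `J|_P` is non-degenerate; for invertible alternating `J` then `P^⊥` is again such a plane and
  `{P, P^⊥}` is a decomposition of `k⁴` into two orthogonal hyperbolic planes.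
* `StabilizesPlanePair J P M` — the matrix `M` maps `P` onto `P` or onto `P^⊥`
  (`P.map M ∈ {P, P^⊥}`; a similitude mapping `P` to `P` maps `P^⊥` to `P^⊥`, and one mapping
  `P` to `P^⊥` maps `P^⊥` to `P^{⊥⊥} = P`, so for similitudes of an invertible alternating `J`
  this IS "stabilises the unordered pair `{P, P^⊥}`").
* `FramedGaloisRep.HasDecompositionStabilizerImage J ρ` — the IMAGE of `ρ : Γ_F → GL₄(k)` is
  EXACTLY the stabiliser in `GSp(J)(k)` of `{P, P^⊥}` for some non-degenerate plane `P`: every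
  `ρ(σ)` stabilises the pair, and every similitude of `J` (`Mᵀ J M = c J`, `c ∈ kˣ`) stabilising the
  pair is some `ρ(σ)` — the same two-sided shape ("contained in" + "exhausts") as the surjectivity
  clause of `Literature.NumberTheory.DiophantineGeometry.bcgp2025_modThreeSurjective_modular_abelianSurface`.
  (That `ρ` is `GSp(J)`-valued is NOT part of this predicate; consumers state it separately, as
  the symplecticity clause of the BCGP facts.)
* API (proved): unfolding lemmas, `mem_jOrthogonal_iff` (the formula `u ⬝ᵥ (J *ᵥ v) = 0`),
  `jOrthogonal_bot`, `StabilizesPlanePair.of_map_eq`, `StabilizesPlanePair.one`.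

## Why this is the printed class `3.45.1` (what reviewers should check)

For `k = 𝔽₃` and `J` invertible alternating (all such forms on `𝔽₃⁴` are equivalent, and `Sp(J)`
is transitive on non-degenerate planes — Witt), the stabiliser `Γ′` of `{P, P^⊥}` in `GSp(J)(𝔽₃)`
consists of the block-diagonal similitudes `(A, B) ∈ GL(P) × GL(P^⊥)` with `det A = det B = ν`
and the block-anti-diagonal ones swapping `P` and `P^⊥`; hence `|Γ′| = 2 · #{(A, B) ∈ GL₂(𝔽₃)² :
det A = det B} = 2 · 1152 = 2304 = 103680 / 45`, `ν(Γ′) = 𝔽₃ˣ`, `Γ = Γ′ ∩ Sp₄(𝔽₃) =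
(SL₂(𝔽₃) × SL₂(𝔽₃)) ⋊ 2` of order `1152`, `−1 ∈ Γ`, and `Γ` is absolutely irreducible on `𝔽₃⁴`
(its only invariant subspaces over `𝔽̄₃` inside `P ⊕ P^⊥` would be `P`, `P^⊥`, killed by the
swap; machine-checked by the cell: every `Γ`-orbit spans `𝔽₃⁴` and the commutant of `Γ` in
`M₄(𝔽₃)` is `𝔽₃`, `run/shared/lean/pub/pub-residmod/lit/ndec_check_litg3.py`).  Table 6.4.4 of
the source is the list of ALL conjugacy classes `Γ′ ≤ GSp₄(𝔽₃)` with `ν(Γ′) ≠ 1` and `Γ`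
absolutely irreducible (its caption), LMFDB labels `3.i.n` carry the index `i = [GSp₄(𝔽₃) : Γ′]`
(proof of Lemma 6.4.3, chunk p0103 L29–31, verbatim: "The LMFDB subgroup labels (which for proper
subgroups are of the form `3.i.n` where `i = [GSp₄(𝔽₃):Γ′]`) determine `Γ′` up to conjugacy in
`GSp₄(𝔽₃)`"), and exactly one of its 25 rows has index `45`: `3.45.1 | 2304 | 1152 | ✓`
(arXiv e-print source of Table 6.4.4, transcribed in the cell's
`lit/BCGP25-Lemma6.4.3-Table6.4.4-source.tex`).  So a `ρ` with `HasDecompositionStabilizerImage J ρ`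
and `GSp(J)`-valued has image in the class `3.45.1`, one of "the 15 subgroups listed in Lemma
6.4.3" of Theorem 9.5.2 (1).  (The cell's independent reconstructions of the subgroup lattice of
`GSp₄(𝔽₃)` name the same class `N_dec = M45`, "stabiliser of a non-degenerate decomposition ⊥-sum
of two planes (2304, 45)", `cert/CERT-FORMAT-v1.md` §3b, tables ×2.)  Since `−1 ∈ Γ′`, the class
is the same whether one reads the image on `A[3]` or on its dual `H¹(A_ℚ̄, 𝔽₃)` (the source's
`ρ̄_{A,3}`, §1.8.23; the two differ by `g ↦ ν(g) g⁻ᵀ ∼ ν(g) g` inside `GSp₄`).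

## References

* [BoxerCalegariGeePilloni2025] G. Boxer, F. Calegari, T. Gee, V. Pilloni, *Modularity theorems for
  abelian surfaces*, arXiv:2502.20645 (2025): §6.4 Lemma 6.4.3 and Table 6.4.4 (row `3.45.1`),
  proof of Lemma 6.4.3 (LMFDB label = index), Theorem 9.5.2 (1), §10.1 (the curve of conductor
  `7³ · 23`, image of order `2304`).
* [BoxerEtAl2021] G. Boxer, F. Calegari, T. Gee, V. Pilloni, Publ. Math. IHÉS 134 (2021), §2.1
  (`GSp₄` as the similitude group of `J`).
-/

noncomputable section

open scoped MatrixGroups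
open Matrix

namespace Literature.NumberTheory.GaloisRepresentations

universe u v

section PlanePair

variable {k : Type u} [Field k] {n : ℕ}

/-- **`P^⊥` for the Gram matrix `J`**: the vectors `v` with `uᵀ J v = 0` for all `u ∈ P`
(Mathlib's right orthogonal `LinearMap.BilinForm.orthogonal` of the bilinear form
`Matrix.toBilin' J`, `(u, v) ↦ ∑ u i * J i j * v j`). [cite: BoxerEtAl2021, §2.1 (the symplectic form with Gram matrix J)] -/
def jOrthogonal (J : Matrix (Fin n) (Fin n) k) (P : Submodule k (Fin n → k)) :
    Submodule k (Fin n → k) :=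
  (Matrix.toBilin' J).orthogonal P

/-- Membership in `jOrthogonal J P`: `v ∈ P^⊥ ⟺ ∀ u ∈ P, u ⬝ᵥ (J *ᵥ v) = 0` (`= uᵀ J v`). [cite: BoxerEtAl2021, §2.1] -/
lemma mem_jOrthogonal_iff (J : Matrix (Fin n) (Fin n) k) (P : Submodule k (Fin n → k))
    (v : Fin n → k) : v ∈ jOrthogonal J P ↔ ∀ u ∈ P, u ⬝ᵥ (J *ᵥ v) = 0 := by
  simp only [jOrthogonal, LinearMap.BilinForm.mem_orthogonal_iff, Matrix.toBilin'_apply']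

/-- `0^⊥ = k^n` (API for `jOrthogonal`; Mathlib `LinearMap.BilinForm.orthogonal_bot`). [cite: BoxerEtAl2021, §2.1 (the form with Gram matrix J)] -/
@[simp] lemma jOrthogonal_bot (J : Matrix (Fin n) (Fin n) k) : jOrthogonal J ⊥ = ⊤ :=
  LinearMap.BilinForm.orthogonal_bot

/-- **`P` is a non-degenerate plane for `J`**: `dim_k P = 2` and `k^n = P ⊕ P^⊥` (the restriction
of the form to `P` is non-degenerate, equivalently `P ∩ P^⊥ = 0`, and `P + P^⊥` is everything).
For `n = 4` and `J` invertible alternating, `{P, P^⊥}` is then a decomposition of `k⁴` as an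
orthogonal sum of two hyperbolic planes. [cite: BoxerCalegariGeePilloni2025, §6.4 Table 6.4.4 (row 3.45.1: the stabiliser of such a decomposition)] -/
def Submodule.IsNondegeneratePlane (J : Matrix (Fin n) (Fin n) k) (P : Submodule k (Fin n → k)) :
    Prop :=
  Module.finrank k P = 2 ∧ IsCompl P (jOrthogonal J P)

/-- Unfolding lemma for `Submodule.IsNondegeneratePlane`. [cite: BoxerCalegariGeePilloni2025, §6.4 Table 6.4.4] -/
lemma Submodule.isNondegeneratePlane_iff (J : Matrix (Fin n) (Fin n) k)
    (P : Submodule k (Fin n → k)) :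
    Submodule.IsNondegeneratePlane J P ↔ Module.finrank k P = 2 ∧ IsCompl P (jOrthogonal J P) :=
  Iff.rfl

/-- **`M` stabilises the unordered pair `{P, P^⊥}`**: `M` maps `P` onto `P` or onto `P^⊥`
(`Submodule.map` along `Matrix.toLin' M`, `v ↦ M *ᵥ v`).  For a similitude `M` of an invertible
alternating `J` this is equivalent to permuting `{P, P^⊥}` (module docstring). [cite: BoxerCalegariGeePilloni2025, §6.4 Table 6.4.4 (row 3.45.1)] -/
def StabilizesPlanePair (J : Matrix (Fin n) (Fin n) k) (P : Submodule k (Fin n → k))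
    (M : Matrix (Fin n) (Fin n) k) : Prop :=
  P.map (Matrix.toLin' M) = P ∨ P.map (Matrix.toLin' M) = jOrthogonal J P

/-- Unfolding lemma for `StabilizesPlanePair`. [cite: BoxerCalegariGeePilloni2025, §6.4 Table 6.4.4] -/
lemma stabilizesPlanePair_iff (J : Matrix (Fin n) (Fin n) k) (P : Submodule k (Fin n → k))
    (M : Matrix (Fin n) (Fin n) k) :
    StabilizesPlanePair J P M ↔
      P.map (Matrix.toLin' M) = P ∨ P.map (Matrix.toLin' M) = jOrthogonal J P :=
  Iff.rfl

/-- A matrix mapping `P` onto `P` stabilises the pair (API for `StabilizesPlanePair`). [cite: BoxerCalegariGeePilloni2025, §6.4 Table 6.4.4 (row 3.45.1)] -/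
lemma StabilizesPlanePair.of_map_eq {J : Matrix (Fin n) (Fin n) k} {P : Submodule k (Fin n → k)}
    {M : Matrix (Fin n) (Fin n) k} (h : P.map (Matrix.toLin' M) = P) : StabilizesPlanePair J P M :=
  Or.inl h

/-- The identity matrix stabilises every pair (API for `StabilizesPlanePair`). [cite: BoxerCalegariGeePilloni2025, §6.4 Table 6.4.4 (row 3.45.1)] -/
lemma StabilizesPlanePair.one (J : Matrix (Fin n) (Fin n) k) (P : Submodule k (Fin n → k)) :
    StabilizesPlanePair J P 1 :=
  StabilizesPlanePair.of_map_eq (by rw [Matrix.toLin'_one, Submodule.map_id])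

end PlanePair

section Image

variable {F : Type v} [Field F] {k : Type u} [Field k] [TopologicalSpace k]

/-- **The image of `ρ : Γ_F → GL₄(k)` is exactly the stabiliser in `GSp(J)(k)` of a non-degenerate
decomposition `k⁴ = P ⊕ P^⊥`** (for `k = 𝔽₃`: the class `3.45.1 | 2304 | 1152 | ✓` of BCGP 2025
Table 6.4.4, the maximal subgroup `N_dec` of index `45`; module docstring): there is a
non-degenerate plane `P` such that (i) every `ρ(σ)` maps `P` onto `P` or onto `P^⊥`, and
(ii) every similitude `M` of `J` (`Mᵀ J M = c J`, `c ∈ kˣ`) mapping `P` onto `P` or onto `P^⊥` is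
`ρ(σ)` for some `σ`.  That `ρ` itself is `GSp(J)`-valued is stated separately by consumers. [cite: BoxerCalegariGeePilloni2025, Theorem 9.5.2 (1) with Lemma 6.4.3 / Table 6.4.4 row 3.45.1, and §10.1 ("image of order 2304")] -/
def FramedGaloisRep.HasDecompositionStabilizerImage (J : Matrix (Fin 4) (Fin 4) k)
    (ρ : FramedGaloisRep F k 4) : Prop :=
  ∃ P : Submodule k (Fin 4 → k), Submodule.IsNondegeneratePlane J P ∧
    (∀ σ : Field.absoluteGaloisGroup F,
      StabilizesPlanePair J P ((ρ σ : GL (Fin 4) k) : Matrix (Fin 4) (Fin 4) k)) ∧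
    (∀ M : Matrix (Fin 4) (Fin 4) k, (∃ c : kˣ, Mᵀ * J * M = (c : k) • J) →
      StabilizesPlanePair J P M →
        ∃ σ : Field.absoluteGaloisGroup F, ((ρ σ : GL (Fin 4) k) : Matrix (Fin 4) (Fin 4) k) = M)

/-- Unfolding lemma for `FramedGaloisRep.HasDecompositionStabilizerImage` (the predicate verbatim). [cite: BoxerCalegariGeePilloni2025, Theorem 9.5.2 (1), Table 6.4.4 row 3.45.1] -/
lemma FramedGaloisRep.hasDecompositionStabilizerImage_iff (J : Matrix (Fin 4) (Fin 4) k)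
    (ρ : FramedGaloisRep F k 4) :
    ρ.HasDecompositionStabilizerImage J ↔
      ∃ P : Submodule k (Fin 4 → k), Submodule.IsNondegeneratePlane J P ∧
        (∀ σ : Field.absoluteGaloisGroup F,
          StabilizesPlanePair J P ((ρ σ : GL (Fin 4) k) : Matrix (Fin 4) (Fin 4) k)) ∧
        (∀ M : Matrix (Fin 4) (Fin 4) k, (∃ c : kˣ, Mᵀ * J * M = (c : k) • J) →
          StabilizesPlanePair J P M →
            ∃ σ : Field.absoluteGaloisGroup F,
              ((ρ σ : GL (Fin 4) k) : Matrix (Fin 4) (Fin 4) k) = M) :=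
  Iff.rfl

/-- The "exhausts" half: under `HasDecompositionStabilizerImage`, the identity-stabilised pair gives
in particular that every similitude stabilising the pair lies in the image `ρ(Γ_F)`
(`FramedGaloisRep.imageOn ρ ⊤`). [cite: BoxerCalegariGeePilloni2025, Theorem 9.5.2 (1)] -/
lemma FramedGaloisRep.HasDecompositionStabilizerImage.exists_mem_imageOn
    {J : Matrix (Fin 4) (Fin 4) k} {ρ : FramedGaloisRep F k 4}
    (h : ρ.HasDecompositionStabilizerImage J) :
    ∃ P : Submodule k (Fin 4 → k), Submodule.IsNondegeneratePlane J P ∧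
      ∀ M : GL (Fin 4) k, (∃ c : kˣ, (M : Matrix (Fin 4) (Fin 4) k)ᵀ * J * M = (c : k) • J) →
        StabilizesPlanePair J P M → M ∈ ρ.imageOn ⊤ := by
  obtain ⟨P, hP, -, hex⟩ := h
  refine ⟨P, hP, fun M hM hstab => ?_⟩
  obtain ⟨σ, hσ⟩ := hex M hM hstab
  exact (ρ.mem_imageOn_iff ⊤ M).2 ⟨σ, Subgroup.mem_top σ, Units.ext hσ⟩

end Image

end Literature.NumberTheory.GaloisRepresentations
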